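import Summits.HodgeConjecture.HodgeConjecture.Theorems.NikulinTwinTransportLefschetzOneOneK3ChernCharacter
import Literature.AlgebraicGeometry.HodgeTheory.LefschetzOneOneOfGlobalSections
import Literature.AlgebraicGeometry.HodgeTheory.CartierDivisorChernClass

/-!
# Route NikulinTwinTransport — `LefschetzOneOneK3`: the residual input with an ALGEBRAIC twist

Helper file (`--supports stmt-HodgeConjecture-13678`) for the route item `LefschetzOneOneK3`
(Lefschetz `(1,1)` for the projective K3 surfaces of the route). State of the item: the analytic
Lefschetz `(1,1)` theorem, Čech integrality, Chow's theorem, the meromorphic section `σ₁/σ₂` and the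
algebraicity of `c₁(𝒪_X(D)^an)` are all proved in the tree, so that the item follows from the
Kodaira–Serre existence of sections alone (`lefschetzOneOneK3_of_globalSections`: for every cocycle line
bundle `L` on a Hodge model, SOME cocycle line bundle `L'` with non-zero sections `σ₁` of `L ⊗ L'` and
`σ₂` of `L'`), equivalently from GAGA for line bundles (`lefschetzOneOneK3_of_serreGAGA`).

Voisin I, proof of Cor. 11.34, takes `L' = H^{⊗N}` with `H` the (algebraic) hyperplane bundle and `σ₂`
any non-zero section of `H^{⊗N}`. This file supplies that half of the input from the algebraic side,
PROVED, so that the residual is literally "a non-zero holomorphic section of `L ⊗ 𝒪_X(D)^an` for some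
Cartier divisor `D` carrying a non-zero algebraic section" (Serre, GAGA n° 16–17 / Kodaira):

* `exists_globalSection_cartierDivisorLineBundle_zeroSet_ne_univ` — **a non-zero algebraic global
  section `s ∈ Γ(X, 𝒪_X(D))` (`D.IsSection s`, Görtz–Wedhorn I (11.9)) gives a NON-ZERO holomorphic
  global section `s^an` of `𝒪_X(D)^an`** (`cartierDivisorLineBundle`, Voisin's frame convention):
  coordinates `s_i = (f_i s)(φ m)` (`CartierDivisor.sectionCoord`, holomorphic, transforming by the
  cocycle — `AnalytificationCartierDivisor`); non-vanishing over `X_s(ℂ)`, which has a complex point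
  (`X_s ≠ ∅`, `CartierDivisor.nonvanishing_nonempty`; Jacobson + Nullstellensatz,
  `ComplexPoints.equivClosedPoints`; `φ` is onto `X(ℂ)`);
* `lefschetzOneOneK3_of_exists_section_algebraicTwist` — **the item from: every holomorphic line
  cocycle `L` on a Hodge model of a surface of the item admits a Cartier divisor `D` with a non-zero
  algebraic section and a non-zero holomorphic section of `L ⊗ 𝒪(D)^an`**;
* `lefschetzOneOne_rational_of_exists_section_algebraicTwist` — the same for the named fact
  `lefschetzOneOne_rational` in all dimensions.
-/

noncomputable section

namespace Summit.HodgeConjecture.HodgeConjecture.Theorems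

open scoped Manifold ContDiff
open Set AlgebraicGeometry
open Literature.Geometry.Kaehler
open Literature.AlgebraicGeometry
open Literature.AlgebraicGeometry.Motives
open Literature.AlgebraicGeometry.HodgeTheory
open Literature.NumberTheory.Transcendental
open Summit.HodgeConjecture.HodgeConjecture.Theses.NikulinTwinTransport

/-! ### The holomorphic section `s^an` of `𝒪_X(D)^an` of an algebraic section `s` -/

section CanonicalSection

variable {X : SchemeOver ℂ} [IsIntegral X.left] {n : ℕ}
  {E : Type*} [NormedAddCommGroup E] [NormedSpace ℂ E] [FiniteDimensional ℂ E]
  {M : Type*} [TopologicalSpace M] [ChartedSpace E M]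
  {φ : M → ComplexPoints X} (hφ : IsAnalytification E X n φ) (D : CartierDivisor X.left)
  {s : X.left.functionField}

/-- **A non-zero algebraic section `s ∈ Γ(X, 𝒪_X(D))` gives a non-zero holomorphic global section
`s^an` of `𝒪_X(D)^an`** (`cartierDivisorLineBundle`, Voisin's frame convention). In the frame over
`φ⁻¹(U_i(ℂ))` the coordinate of `s^an` is the value `(f_i s)(φ m)` of the regular function `f_i s`
(`CartierDivisor.sectionCoord`; Görtz–Wedhorn I (11.9): `Γ(X, 𝒪_X(D)) = {s ∈ K(X) ; f_i s ∈ Γ(U_i, 𝒪_X)}`),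
holomorphic on an analytification (Serre, GAGA §2 n° 6) and transforming by the cocycle
(`sectionCoord_eq_mul`) — the easy (`H⁰`) direction of GAGA for `𝒪_X(D)`. It is non-zero: `X_s` is a
non-empty Zariski open subset (`CartierDivisor.nonvanishing_nonempty`), so it contains a closed point
(`X` is Jacobson, being locally of finite type over `ℂ`), which underlies a complex point
(Nullstellensatz, `ComplexPoints.equivClosedPoints`), which is `φ m` for some `m` (`φ` is onto `X(ℂ)`);
and `(f_i s)(φ m) ≠ 0` there (`sectionCoord_ne_zero`).
[cite: SerreGAGA1956, §2 n°6 and §3 n°9] [cite: GortzWedhorn2020, Section (11.9) (p. 374) and Prop. 3.35] -/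
theorem exists_globalSection_cartierDivisorLineBundle_zeroSet_ne_univ [LocallyOfFiniteType X.hom]
    (hs : D.IsSection s) (hs0 : s ≠ 0) :
    ∃ τ : (cartierDivisorLineBundle hφ D).GlobalSection, τ.zeroSet ≠ univ := by
  refine ⟨⟨fun i ↦ D.sectionCoord φ hs i, fun i ↦ mdifferentiableOn_sectionCoord hφ hs i,
    fun _ _ _ hm ↦ sectionCoord_eq_mul hs hm.1 hm.2⟩, ?_⟩
  haveI : JacobsonSpace X.left := LocallyOfFiniteType.jacobsonSpace X.hom
  obtain ⟨y, hyU, hy⟩ :=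
    nonempty_inter_closedPoints (D.nonvanishing_nonempty hs0) (D.isOpen_nonvanishing s).isLocallyClosed
  set P : ComplexPoints X := (ComplexPoints.equivClosedPoints X).symm ⟨y, hy⟩ with hP
  have hPpt : P.pt = y := by
    have h := ComplexPoints.coe_equivClosedPoints_apply X P
    rw [hP, Equiv.apply_symm_apply] at h
    exact h.symm
  obtain ⟨m, hm⟩ := hφ.isHomeomorph.surjective P
  have hmU : (φ m).pt ∈ D.nonvanishing s := by
    rw [hm, hPpt]
    exact hyU
  rw [Ne, eq_univ_iff_forall, not_forall]
  exact ⟨m, fun ⟨i, hi, h0⟩ ↦ sectionCoord_ne_zero hs hi hmU h0⟩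

end CanonicalSection

/-! ### The item from Kodaira–Serre sections with an algebraic twist -/

/-- **`LefschetzOneOneK3` from the existence of ONE non-zero holomorphic section of an ALGEBRAIC twist.**
If on every Hodge model `A` of a surface `S` of the item every holomorphic line cocycle `L` admits a
Cartier divisor `D` on `S` with a non-zero algebraic global section `s ∈ Γ(S, 𝒪_S(D))` (e.g. `D = N·H`
a multiple of a hyperplane section, `s = 1`) and a non-zero holomorphic global section `σ` of
`L ⊗ 𝒪_S(D)^an` — Voisin I, proof of Cor. 11.34: "for sufficiently large `N`, `L ⊗ H^{⊗N}` and `H^{⊗N}`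
admit non-zero holomorphic sections `σ₁, σ₂`", the second being here the algebraic `s^an`
(`exists_globalSection_cartierDivisorLineBundle_zeroSet_ne_univ`, proved) — then `LefschetzOneOneK3` holds
(`lefschetzOneOneK3_of_globalSections`: the quotient `σ/s^an`, Čech integrality, Chow and the analytic
Lefschetz `(1,1)` theorem are proved in the tree). The hypothesis is the Kodaira–Serre theorem
(Serre, GAGA n° 16 Théorème A–B for the coherent analytic sheaf of sections of `L`; Kodaira) — not in
the tree. [cite: VoisinHodgeI2002, Cor. 11.34 (proof) and Thm. 11.30] [cite: SerreGAGA1956, n° 16–17] -/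
theorem lefschetzOneOneK3_of_exists_section_algebraicTwist
    (h : ∀ ⦃S : Motives.SchemeOver ℂ⦄
      (hS : Motives.IsSmoothProjective 2 S ∧ Subsingleton (Motives.structureSheafCohomology S.left 1) ∧
        ∃ (A : HodgeModel 2 S) (η : MForm 𝓘(ℝ, A.model) A.carrier ℂ 2),
          Literature.Geometry.Kaehler.IsHolomorphicInCharts η ∧ ∀ x, η x ≠ 0),
      letI : IsIntegral S.left := Motives.IsSmoothProjective.isIntegral_holds hS.1
      ∀ (A : HodgeModel 2 S) (ι : Type) (L : HolomorphicLineBundle ι A.model A.carrier),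
        ∃ (D : CartierDivisor S.left) (s : S.left.functionField) (_ : D.IsSection s), s ≠ 0 ∧
          ∃ σ : (L.tensor (cartierDivisorLineBundle A.isAnalytification D)).GlobalSection,
            σ.zeroSet ≠ univ) :
    LefschetzOneOneK3 := by
  refine lefschetzOneOneK3_of_globalSections fun S hS A ι L ↦ ?_
  letI : IsIntegral S.left := Motives.IsSmoothProjective.isIntegral_holds hS.1
  haveI := hS.1.smoothOfRelativeDimension
  haveI : Smooth S.hom := SmoothOfRelativeDimension.smooth 2 S.hom
  obtain ⟨D, s, hs, hs0, σ, hσ⟩ := h hS A ι L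
  obtain ⟨τ, hτ⟩ :=
    exists_globalSection_cartierDivisorLineBundle_zeroSet_ne_univ A.isAnalytification D hs hs0
  exact ⟨D.ι, cartierDivisorLineBundle A.isAnalytification D, σ, τ, hσ, hτ⟩

/-- **The named fact `lefschetzOneOne_rational` (all dimensions) from the same algebraically twisted
Kodaira–Serre sections** (`Literature…lefschetzOneOne_rational_of_globalSections` with `L' = 𝒪_X(D)^an`
and `σ₂ = s^an`). [cite: VoisinHodgeI2002, Cor. 11.34 (proof), Thm. 11.30 and §11.3.2] [cite: SerreGAGA1956, n° 16–17] -/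
theorem lefschetzOneOne_rational_of_exists_section_algebraicTwist
    (h : ∀ ⦃n : ℕ⦄ ⦃X : Motives.SchemeOver ℂ⦄ (hX : Motives.IsSmoothProjective n X),
      letI : IsIntegral X.left := Motives.IsSmoothProjective.isIntegral_holds hX
      ∀ (A : HodgeModel n X) (ι : Type) (L : HolomorphicLineBundle ι A.model A.carrier),
        ∃ (D : CartierDivisor X.left) (s : X.left.functionField) (_ : D.IsSection s), s ≠ 0 ∧
          ∃ σ : (L.tensor (cartierDivisorLineBundle A.isAnalytification D)).GlobalSection,
            σ.zeroSet ≠ univ) :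
    lefschetzOneOne_rational := by
  refine lefschetzOneOne_rational_of_globalSections fun n X hX A ι L ↦ ?_
  letI : IsIntegral X.left := Motives.IsSmoothProjective.isIntegral_holds hX
  haveI := hX.smoothOfRelativeDimension
  haveI : Smooth X.hom := SmoothOfRelativeDimension.smooth n X.hom
  obtain ⟨D, s, hs, hs0, σ, hσ⟩ := h hX A ι L
  obtain ⟨τ, hτ⟩ :=
    exists_globalSection_cartierDivisorLineBundle_zeroSet_ne_univ A.isAnalytification D hs hs0
  exact ⟨D.ι, cartierDivisorLineBundle A.isAnalytification D, σ, τ, hσ, hτ⟩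

end Summit.HodgeConjecture.HodgeConjecture.Theorems

end
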